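import Literature.NumberTheory.Rogawski1990.LocalTransferExplicitNonsplit      -- ★ the letter's frame: `finExplicitCollection`, `IsLocalGRegular`, `IsLocalStablyConjH`, `stableOrbitalIntegralRel`
import Literature.NumberTheory.Automorphic.LocalStableOrbitalFinite             -- ★ `stableOrbitalIntegralRel_smul_fun` (dialect), `classOrbitalIntegral_eq`
import HarnessLib

/-!
# The `μ`-TWIST REDUCTION for the `Δ‴`-transfer at the identity: a twist of `τ_v` by a smooth stable class function of `γ_H` carries a
# local transfer for `μ` to a local transfer for `μ′` (Rogawski 1990, §4.9: `μ` enters `Δ‴_v` only through `τ_v(γ_H)`)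

Topic `NumberTheory/Rogawski1990`; namespace `Literature.NumberTheory.Rogawski1990`.  THEOREMS ONLY (no definition, no instance, no notation, no named
fact, no `sorry`).  Cell `pub/hodgecm-mathlib`, crux H413 = `stmt-HodgeConjecture-24833`, road «S3-tree», residue letter «S3-res», scope note (H1) of the
census `F0/P3a/F0P3a-p06/g15/CENSUS-S3res-placeGenericity.F0P3a-p06g15.md` (architect A-179: «S3-res» ⊇ {`v` inert, `v ∤ 2`, `μ_v` ramified}; organ
candidate «μ-twist reduction»).  HONEST LABEL: HC_CM is proved only modulo the 2 remaining named inputs (hLiu418 24832, h413 24833) until rung 0 closes;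
this file is unconditional bookkeeping over its hypotheses and is place-generic (any finite `v`, any residue characteristic, any hermitian `H′`).

THE MATHEMATICS.  Rogawski's explicit finite-place factor is `Δ‴_v(γ_H, γ′) = τ_v(γ_H) · D_{G∕H,v}(γ_H) · κ_v(γ_H, γ′)` on matching pairs and `0`
off them (★ `finExplicitDelta_of_isLocalNormPair` ∕ `…_of_not_isLocalNormPair`), and the endoscopic character `μ` enters ONLY through the
`γ′`-FREE factor `τ_v(γ_H) = μ_v(γ₂) · μ_v((γ₂γ₁⁻¹ − 1)(1 − γ₂γ₃⁻¹))⁻¹` (★ `finTau`) [Rogawski1990, §4.9 p. 55].  Hence if two characters `μ, μ′`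
satisfy `τ_v[μ′](γ_H) = ρ(γ_H) · τ_v[μ](γ_H)` for the `G`-regular `γ_H` near `1`, with `ρ` locally constant, conjugation-invariant and constant on
stable classes of `H_v`, then `Δ‴_v[μ′] = ρ(γ_H) · Δ‴_v[μ]` there (§2, (T1)), and a local transfer `(V, φ^H)` of `φ` at the identity for `μ`
(`Φ^st(γ_H, φ^H) = Σᶠ_c Δ‴_v[μ](γ_H, c) · Φ(c, φ)` on `V`) yields the local transfer `(V ∩ V₀, ρ · φ^H)` for `μ′`: `Φ^st(γ_H, ρ·φ^H) =
ρ(γ_H) · Φ^st(γ_H, φ^H)` because `ρ` is constant on every conjugacy class (orbital integrals, §1) and on the stable class of `γ_H` (stable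
orbital integrals, §1), and `ρ · φ^H ∈ C_c^∞` [Rogawski1990, §4.3 (4.3.1) p. 43; §4.9 Prop. 4.9.1 p. 55].  (For unitary `μ, μ′` with the same
restriction `ω_{L∕L⁺}` to `𝕀_{L⁺}` one has `ρ = χ̃ ∘ det ∘ pr₁` with `χ̃` the character of `L_w^1` attached to `μ′_w ∕ μ_w` by Hilbert 90 — the
identification (T3) of the census, NOT in this file.)

* §1 (generic group `G`, any orbital-measure family): `classOrbitalIntegral_mul_of_forall_conj_eq` (a conjugation-invariant multiplier comes out of an
  orbital integral), `stableOrbitalIntegralRel_mul_of_forall_eq` (… and out of a stable orbital integral when constant on the stable class),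
  **`exists_nhds_stableOrbitalIntegralRel_eq_finsum_of_twist`** (the abstract twist transport of «transfer at the identity»).
* §2 (`(U(3)(L⁺_v), U(Φ₂) × U(Φ₁))`, Rogawski's `Δ‴_v`): `finExplicitDelta_eq_mul_of_finTau_eq` (T1),
  **`exists_nhds_localTransferAtOne_of_finTau_twist`** (T2) — the `stub_N6nsS3id` conclusion at `v` for `(μ′, φ)` from the one for `(μ, φ)`.

## References
* [Rogawski1990] J. D. Rogawski, *Automorphic Representations of Unitary Groups in Three Variables*, Ann. of Math. Stud. 123 (1990), §4.9
  Prop. 4.9.1 p. 55 (the factor `τ_v`), §4.3 (4.3.1)–(4.3.2) p. 43 (`Δ`-transfer), §4.1 (4.1.1) p. 39 (`Φ^st`).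
* [LanglandsShelstad1987] R. P. Langlands, D. Shelstad, *On the definition of transfer factors*, Math. Ann. 278 (1987), §4.2 (dependence on the
  endoscopic datum's character).
-/

set_option autoImplicit false

noncomputable section

open MeasureTheory Measure Set Filter Topology NumberField IsDedekindDomain
open scoped Matrix MatrixGroups

/-! ## §1 Generic: a class-function multiplier comes out of orbital and stable orbital integrals; twist transport of «transfer at 1» -/

namespace Literature.NumberTheory.Automorphic

section Orbital

variable {G : Type*} [Group G] [∀ γ : G, MeasurableSpace (G ⧸ Subgroup.centralizer ({γ} : Set G))]

/-- **A conjugation-invariant multiplier comes out of the orbital integral**: if `ρ(g γ_c g⁻¹) = ρ(γ_c)` for all `g` (`γ_c = out c`), then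
`Φ(c, ρ·f) = ρ(γ_c) · Φ(c, f)` for ANY orbital measure (the orbital integrand of `ρ·f` is `ρ(γ_c)` times that of `f`; ★ `orbitalIntegral_smul`).
[cite: Rogawski1990, §4.1 (4.1.1) p. 39; §4.9 p. 54] -/
theorem classOrbitalIntegral_mul_of_forall_conj_eq (m : OrbitalMeasureFamily G) (ρ f : G → ℂ) (c : ConjClasses G)
    (hρ : ∀ g : G, ρ (g * Quotient.out c * g⁻¹) = ρ (Quotient.out c)) :
    classOrbitalIntegral m (fun x => ρ x * f x) c = ρ (Quotient.out c) * classOrbitalIntegral m f c := by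
  have hfun : (fun x => ρ x * f x) = fun x => ρ x • f x := rfl
  rw [classOrbitalIntegral_eq, classOrbitalIntegral_eq, ← smul_eq_mul, ← orbitalIntegral_smul, orbitalIntegral_eq_integral_descConj,
    orbitalIntegral_eq_integral_descConj]
  refine integral_congr_ae (Eventually.of_forall fun y => ?_)
  induction y using QuotientGroup.induction_on with
  | H g => exact congrArg (fun z : ℂ => z * f (g * Quotient.out c * g⁻¹)) (hρ g)

/-- **A multiplier that is conjugation-invariant and constant on the stable class of `γ` comes out of the stable orbital integral**:
`Φ^st(γ, ρ·f) = ρ(γ) · Φ^st(γ, f)` (class by class by `classOrbitalIntegral_mul_of_forall_conj_eq`, then Mathlib `mul_finsum_mem`; no finiteness needed).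
[cite: Rogawski1990, §4.1 (4.1.1) p. 39] -/
theorem stableOrbitalIntegralRel_mul_of_forall_eq (st : G → G → Prop) (m : OrbitalMeasureFamily G) (ρ f : G → ℂ) (γ : G)
    (hρ : ∀ g x : G, ρ (g * x * g⁻¹) = ρ x) (hst : ∀ x : G, st γ x → ρ x = ρ γ) :
    Rogawski1990.stableOrbitalIntegralRel st m (fun x => ρ x * f x) γ = ρ γ * Rogawski1990.stableOrbitalIntegralRel st m f γ := by
  simp only [Rogawski1990.stableOrbitalIntegralRel_def, mul_finsum_mem]
  refine finsum_mem_congr rfl fun c hc => ?_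
  rw [classOrbitalIntegral_mul_of_forall_conj_eq m ρ f c (fun g => hρ g _), hst _ hc]

end Orbital

section Twist

variable {A : Type*} [Group A] [TopologicalSpace A] [∀ a : A, MeasurableSpace (A ⧸ Subgroup.centralizer ({a} : Set A))]
  {G : Type*} [Group G] [∀ γ : G, MeasurableSpace (G ⧸ Subgroup.centralizer ({γ} : Set G))]

/-- **TWIST TRANSPORT OF «TRANSFER AT THE IDENTITY» (abstract).**  Two factors `Δ, Δ′ : A → G → ℂ` with `Δ′(a, ·) = ρ(a) · Δ(a, ·)` for the
`regA`-regular `a` in a neighbourhood `V₀` of `1`, where `ρ : A → ℂ` is locally constant, conjugation-invariant and constant on `stA`-classes: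
a transfer `(V, φ^H)` of `φ` for `Δ` (`Φ^st(a, φ^H) = Σᶠ_c Δ(a, out c) · Φ(c, φ)` for regular `a ∈ V`, `φ^H ∈ C_c^∞`) gives the transfer
`(V ∩ V₀, ρ · φ^H)` of `φ` for `Δ′`. [cite: Rogawski1990, §4.3 (4.3.1) p. 43; §4.9 Prop. 4.9.1 p. 55] [cite: LanglandsShelstad1987, §4.2] -/
theorem exists_nhds_stableOrbitalIntegralRel_eq_finsum_of_twist (stA : A → A → Prop) (regA : A → Prop)
    (mH : OrbitalMeasureFamily A) (mG : OrbitalMeasureFamily G) (Δ Δ' : A → G → ℂ) (ρ : A → ℂ)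
    (hρ : IsLocallyConstant ρ) (hρc : ∀ g x : A, ρ (g * x * g⁻¹) = ρ x) (hρs : ∀ a b : A, stA a b → ρ b = ρ a)
    {V₀ : Set A} (hV₀ : V₀ ∈ 𝓝 (1 : A)) (hΔ : ∀ a ∈ V₀, regA a → ∀ x : G, Δ' a x = ρ a * Δ a x) (φ : G → ℂ)
    (h : ∃ V ∈ 𝓝 (1 : A), ∃ φH : A → ℂ, Rogawski1990.IsLocSmooth φH ∧
      ∀ a ∈ V, regA a → Rogawski1990.stableOrbitalIntegralRel stA mH φH a = ∑ᶠ c : ConjClasses G, Δ a (Quotient.out c) * classOrbitalIntegral mG φ c) :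
    ∃ V ∈ 𝓝 (1 : A), ∃ φH : A → ℂ, Rogawski1990.IsLocSmooth φH ∧
      ∀ a ∈ V, regA a → Rogawski1990.stableOrbitalIntegralRel stA mH φH a = ∑ᶠ c : ConjClasses G, Δ' a (Quotient.out c) * classOrbitalIntegral mG φ c := by
  obtain ⟨V, hV, φH, hφ, hid⟩ := h
  refine ⟨V ∩ V₀, Filter.inter_mem hV hV₀, fun x => ρ x * φH x, ⟨hρ.mul hφ.1, hφ.2.mul_left⟩, fun a ha hreg => ?_⟩
  rw [stableOrbitalIntegralRel_mul_of_forall_eq stA mH ρ φH a hρc (fun b hb => hρs a b hb), hid a ha.1 hreg, mul_finsum]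
  exact finsum_congr fun c => by rw [hΔ a ha.2 hreg, mul_assoc]

end Twist

end Literature.NumberTheory.Automorphic

/-! ## §2 Rogawski's `Δ‴_v`: the twist of `τ_v` is a twist of `Δ‴_v`; the `μ`-twist reduction of the transfer at the identity -/

namespace Literature.NumberTheory.Rogawski1990

open Literature.NumberTheory.Automorphic Literature.NumberTheory.Automorphic.UnitaryGroup Literature.NumberTheory.GaloisRepresentations

section CM

variable (L : Type) [Field L] [NumberField L] [IsCMField L] (H' : Matrix (Fin 3) (Fin 3) L) (v : HeightOneSpectrum (𝓞 ↥(maximalRealSubfield L)))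

open scoped Classical in
/-- **(T1) `μ` enters `Δ‴_v` only through `τ_v(γ_H)`**: if `τ_v[μ′](γ_H) = r · τ_v[μ](γ_H)` then `Δ‴_v[μ′](γ_H, γ′) = r · Δ‴_v[μ](γ_H, γ′)` for every
`γ′` (`D_{G∕H,v}` and `κ_v` do not see `μ`; off the matching pairs both sides vanish). [cite: Rogawski1990, §4.9 Prop. 4.9.1 p. 55; §4.3 p. 43] -/
theorem finExplicitDelta_eq_mul_of_finTau_eq
    (γH : (cmDatum L 2 (Matrix.of fun i j : Fin 2 => if i.val + j.val + 1 = 2 then (1 : L) else 0)).Local v ×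
      (cmDatum L 1 (Matrix.of fun i j : Fin 1 => if i.val + j.val + 1 = 1 then (1 : L) else 0)).Local v)
    (μ μ' : HeckeCharacter L) {r : ℂ} (hτ : finTau L v γH μ' = r * finTau L v γH μ) (γ' : (cmDatum L 3 H').Local v) :
    finExplicitDelta L v H' γH μ' γ' = r * finExplicitDelta L v H' γH μ γ' := by
  by_cases h : IsLocalNormPair L H' v γH γ'
  · rw [finExplicitDelta_of_isLocalNormPair L v H' γH μ' h, finExplicitDelta_of_isLocalNormPair L v H' γH μ h, hτ]
    ring
  · rw [finExplicitDelta_of_not_isLocalNormPair L v H' γH μ' h, finExplicitDelta_of_not_isLocalNormPair L v H' γH μ h, mul_zero]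

variable [∀ γ : ((cmDatum L 3 H').Local v), MeasurableSpace (((cmDatum L 3 H').Local v) ⧸ Subgroup.centralizer ({γ} : Set ((cmDatum L 3 H').Local v)))]
  [∀ a : (cmDatum L 2 (Matrix.of fun i j : Fin 2 => if i.val + j.val + 1 = 2 then (1 : L) else 0)).Local v × (cmDatum L 1 (Matrix.of fun i j : Fin 1 => if i.val + j.val + 1 = 1 then (1 : L) else 0)).Local v, MeasurableSpace (((cmDatum L 2 (Matrix.of fun i j : Fin 2 => if i.val + j.val + 1 = 2 then (1 : L) else 0)).Local v × (cmDatum L 1 (Matrix.of fun i j : Fin 1 => if i.val + j.val + 1 = 1 then (1 : L) else 0)).Local v) ⧸ Subgroup.centralizer ({a} : Set ((cmDatum L 2 (Matrix.of fun i j : Fin 2 => if i.val + j.val + 1 = 2 then (1 : L) else 0)).Local v × (cmDatum L 1 (Matrix.of fun i j : Fin 1 => if i.val + j.val + 1 = 1 then (1 : L) else 0)).Local v)))]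

/-- **(T2) THE `μ`-TWIST REDUCTION OF THE `Δ‴`-TRANSFER AT THE IDENTITY.**  Let `μ, μ′` be Hecke characters of `L` and `ρ : H_v → ℂ` locally constant,
conjugation-invariant and constant on the stable classes of `H_v = U(Φ₂)(L⁺_v) × U(Φ₁)(L⁺_v)` (★ `IsLocalStablyConjH`), with
`τ_v[μ′](γ_H) = ρ(γ_H) · τ_v[μ](γ_H)` for every `G`-regular `γ_H` in some `V₀ ∈ 𝓝 1`.  If `φ ∈ C_c^∞(G′_v)` has a `Δ‴_v[μ]`-transfer at the identity
(the conclusion of `stub_N6nsS3id` ∕ of the S3-tree payable at `v` for `(μ, φ)`), then it has a `Δ‴_v[μ′]`-transfer at the identity (the same conclusion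
for `(μ′, φ)`), namely `(V ∩ V₀, ρ · φ^H)`.  Any place `v`, any families `mH, mG`, any hermitian `H′`. [cite: Rogawski1990, §4.9 Prop. 4.9.1 p. 55; §4.3 (4.3.1) p. 43]
[cite: LanglandsShelstad1987, §4.2] -/
theorem exists_nhds_localTransferAtOne_of_finTau_twist
    (mH : OrbitalMeasureFamily ((cmDatum L 2 (Matrix.of fun i j : Fin 2 => if i.val + j.val + 1 = 2 then (1 : L) else 0)).Local v × (cmDatum L 1 (Matrix.of fun i j : Fin 1 => if i.val + j.val + 1 = 1 then (1 : L) else 0)).Local v))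
    (mG : OrbitalMeasureFamily ((cmDatum L 3 H').Local v)) (μ μ' : HeckeCharacter L)
    (ρ : ((cmDatum L 2 (Matrix.of fun i j : Fin 2 => if i.val + j.val + 1 = 2 then (1 : L) else 0)).Local v × (cmDatum L 1 (Matrix.of fun i j : Fin 1 => if i.val + j.val + 1 = 1 then (1 : L) else 0)).Local v) → ℂ)
    (hρ : IsLocallyConstant ρ)
    (hρc : ∀ g x : ((cmDatum L 2 (Matrix.of fun i j : Fin 2 => if i.val + j.val + 1 = 2 then (1 : L) else 0)).Local v × (cmDatum L 1 (Matrix.of fun i j : Fin 1 => if i.val + j.val + 1 = 1 then (1 : L) else 0)).Local v),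
      ρ (g * x * g⁻¹) = ρ x)
    (hρs : ∀ a b : ((cmDatum L 2 (Matrix.of fun i j : Fin 2 => if i.val + j.val + 1 = 2 then (1 : L) else 0)).Local v × (cmDatum L 1 (Matrix.of fun i j : Fin 1 => if i.val + j.val + 1 = 1 then (1 : L) else 0)).Local v),
      IsLocalStablyConjH L v a b → ρ b = ρ a)
    {V₀ : Set ((cmDatum L 2 (Matrix.of fun i j : Fin 2 => if i.val + j.val + 1 = 2 then (1 : L) else 0)).Local v × (cmDatum L 1 (Matrix.of fun i j : Fin 1 => if i.val + j.val + 1 = 1 then (1 : L) else 0)).Local v)}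
    (hV₀ : V₀ ∈ 𝓝 (1 : ((cmDatum L 2 (Matrix.of fun i j : Fin 2 => if i.val + j.val + 1 = 2 then (1 : L) else 0)).Local v × (cmDatum L 1 (Matrix.of fun i j : Fin 1 => if i.val + j.val + 1 = 1 then (1 : L) else 0)).Local v)))
    (hτ : ∀ γH ∈ V₀, IsLocalGRegular L v γH → finTau L v γH μ' = ρ γH * finTau L v γH μ)
    (φ : (cmDatum L 3 H').Local v → ℂ)
    (h : ∃ V ∈ 𝓝 (1 : ((cmDatum L 2 (Matrix.of fun i j : Fin 2 => if i.val + j.val + 1 = 2 then (1 : L) else 0)).Local v × (cmDatum L 1 (Matrix.of fun i j : Fin 1 => if i.val + j.val + 1 = 1 then (1 : L) else 0)).Local v)), ∃ φH : ((cmDatum L 2 (Matrix.of fun i j : Fin 2 => if i.val + j.val + 1 = 2 then (1 : L) else 0)).Local v × (cmDatum L 1 (Matrix.of fun i j : Fin 1 => if i.val + j.val + 1 = 1 then (1 : L) else 0)).Local v) → ℂ, IsLocSmooth φH ∧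
      ∀ γH ∈ V, IsLocalGRegular L v γH →
        stableOrbitalIntegralRel (IsLocalStablyConjH L v) mH φH γH =
          ∑ᶠ c : ConjClasses ((cmDatum L 3 H').Local v),
            ((finExplicitCollection L H' μ (finExplicitDelta_conj_left_all L H' μ) (finExplicitDelta_conj_right_all L H' μ)) v).Δ γH (Quotient.out c) *
              classOrbitalIntegral mG φ c) :
    ∃ V ∈ 𝓝 (1 : ((cmDatum L 2 (Matrix.of fun i j : Fin 2 => if i.val + j.val + 1 = 2 then (1 : L) else 0)).Local v × (cmDatum L 1 (Matrix.of fun i j : Fin 1 => if i.val + j.val + 1 = 1 then (1 : L) else 0)).Local v)), ∃ φH : ((cmDatum L 2 (Matrix.of fun i j : Fin 2 => if i.val + j.val + 1 = 2 then (1 : L) else 0)).Local v × (cmDatum L 1 (Matrix.of fun i j : Fin 1 => if i.val + j.val + 1 = 1 then (1 : L) else 0)).Local v) → ℂ, IsLocSmooth φH ∧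
      ∀ γH ∈ V, IsLocalGRegular L v γH →
        stableOrbitalIntegralRel (IsLocalStablyConjH L v) mH φH γH =
          ∑ᶠ c : ConjClasses ((cmDatum L 3 H').Local v),
            ((finExplicitCollection L H' μ' (finExplicitDelta_conj_left_all L H' μ') (finExplicitDelta_conj_right_all L H' μ')) v).Δ γH (Quotient.out c) *
              classOrbitalIntegral mG φ c := by
  refine exists_nhds_stableOrbitalIntegralRel_eq_finsum_of_twist (IsLocalStablyConjH L v) (IsLocalGRegular L v) mH mG
    (fun a x => ((finExplicitCollection L H' μ (finExplicitDelta_conj_left_all L H' μ) (finExplicitDelta_conj_right_all L H' μ)) v).Δ a x)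
    (fun a x => ((finExplicitCollection L H' μ' (finExplicitDelta_conj_left_all L H' μ') (finExplicitDelta_conj_right_all L H' μ')) v).Δ a x)
    ρ hρ hρc hρs hV₀ (fun a ha hreg x => ?_) φ h
  simp only [finExplicitCollection_Δ]
  exact finExplicitDelta_eq_mul_of_finTau_eq L H' v a μ μ' (hτ a ha hreg) x

end CM

end Literature.NumberTheory.Rogawski1990

end
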